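import Literature.MathematicalPhysics.QuantumFieldTheory.Balaban1983to89.B9Thm311SmallFieldCoercivityTowerClosed
import Literature.MathematicalPhysics.QuantumFieldTheory.Balaban1983to89.B9Thm311SmallFieldCoercivityTower

/-!
# `Balaban1983to89.B9Thm311LaplaceAkPositiveDiagonal` — T. Bałaban, *Propagators for lattice gauge theories in a background field*, Commun. Math. Phys.
# **99** (1985) 389–434 [Balaban1985BackgroundPropagators] Thm 3.11 p. 416 («Δ_a … positive definite») with (3.26) p. 395, (3.69) p. 404, (3.35) p. 396,
# (3.16) p. 393: **PRINT's `k`-TH-STEP OPERATOR `Δ^{(k)}_a(U) = Δ(U) + D R_k(U) D* + Q_k(U)†aQ_k(U)` — WITH THE CURVATURE PART OF THE HESSIAN — IS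
# POSITIVE DEFINITE AT EVERY SMALL FIELD ON PRINT's DIAGONAL, WITH NO DISPLAYED OPERATOR LETTER** — the owner's `B9Thm311SmallFieldCoercivityTowerClosed`
# (the principal part strongly coercive, every letter closed) + the fine-lattice curvature bound `B9Ineq369CurvatureSmall.hpos_of_smallCurvature`
# under print's `O(η²)` plaquette window: THE DISPLAYED `hpos` OF `B9Eq326OperatorTower.G1k ∕ H1k ∕ frakGk` IS A THEOREM ON THE DIAGONAL, so the
# `k`-level Green's functions `G_k`, `H_{1,k}`, `𝔊_k` are CONSTRUCTED there from the windows alone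

statement-level skeleton of published theorems with citation tags; proofs where landed; nothing here is a claim about the Yang–Mills mass gap

CITATION HEADER (lean-in-tree rule).  Audit cell `pub-balaban`, sub-cell `t4`, BINDER row NE9; filed by the row OWNER lineage `b2b-balaban-t4-ne9-p1`
(gen 85), INTENT I-ne9p1-g85-9.  Sources READ by this lineage in the held text `paper:balaban1985-cmp99-background-propagators` (journal page = PDF page
+ 388): pp. 392–396, 404, 407, 416.

THE PRINT (verbatim).  p. 416, Thm 3.11: *«Under the assumptions of the Theorems 3.1–3.10 (i.e. for M sufficiently large and α₀ sufficiently small) the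
operators Δ′_a, G′, (Q′G′²Q′*)⁻¹, Δ_a, G are positive definite.»*; p. 392: the curvature part of the Hessian *«treated as a small perturbation of D*D»*;
p. 396, (3.35): the scaled small-field window (bond variables `O(η)`-close, plaquette variables `O(η²)`-close to the identity).

WHAT IS PROVED (sorry-free; no `def`, no `Prop` placeholder; no inequality of the paper asserted).
* **`exists_coercive_laplaceAk_diagonal_closed`** — the COERCIVE form: `∃ α₀ γ₁ > 0` (closed; `γ₁ = γ(d,a)∕4`) before the same binders with
  `γ₁‖x‖² ≤ re⟨x, Δ^{(n+1)}_a(U)x⟩` (INTENT-8's principal `γ′ = γ(d,a)∕2` minus the curvature form bound `≤ γ′∕2`); hence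
  **`exists_norm_G1k_le_diagonal_closed`** — `‖G_k(U)y‖ ≤ γ₁⁻¹‖y‖` for the `k`-level Green's function `G_k(U) = (Δ^{(n+1)}_a(U))⁻¹`
  (`B11Eq103H1Complex.G1LatticeK` at ANY positivity witness): [B9] Thm 3.4's `L²` operator clause for print's `k`-th-step `G(U)` with a LEVEL-FREE
  constant on the diagonal (no decay).
* **`exists_laplaceAk_pos_diagonal_closed`** — for the block size `L`, fibre letters `M_φ, M_φ′`, `a > 0`, profile ratio `0 ≤ r < 1`, a trace letter
  `C_τ` and a weight ratio bound `ρ_w` THERE IS `α₀ > 0` (closed in `(d, a, L, M_φ, M_φ′, r, C_τ, ρ_w)`) such that for EVERY `n`, `η` with `ηL^{n+1} = 1`,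
  `c₀(L^{n+1})^d = c₁` with `|η|^d∕c₀ ≤ ρ_w` (print's weight `c₀ = η^d` gives `ρ_w = 1`), volume `m`, background `U` (E162's data, `hRS`, `U(b) ∈ U1`,
  `‖U(b) − 1‖ ≤ αη`, PLAQUETTES `‖U(∂p) − 1‖ ≤ αη²`, level averages `‖Ū^j(b) − 1‖ ≤ ε_j ≤ αr^j`) and `0 ≤ α ≤ α₀`:
  `0 < re⟨x, Δ^{(n+1)}_a(U)x⟩` for every `x ≠ 0` — `laplaceAk` WITH the Hessian's curvature part.
MODEL ∕ DECLARED READINGS.  As `…TowerClosed`; the plaquette window `αη²` is DISPLAYED separately from the bond window `αη` (print's (3.35) carries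
both; deriving either from the other ∕ from the action is the gauge step); the weight ratio `|η|^d∕c₀` is DISPLAYED through `ρ_w`.  NOT HERE: KERNEL ∕
decay bounds of the Green's functions ([B9] Thms 3.12∕3.13), the `H_{1,k}` ∕ `𝔊_k` bounds ((3.126) ∕ (3.153)), (117)'s `√#bonds`.
HONEST SCOPE.  [folklore] composition of two landed∕staged results; «NE9 ⇐ the named binders»; NE9 NOT PRINTED ∕ NOT PROVED; NOT summit progress (cell
pub-balaban: row NE9 WALLED ON A MODEL; spine PROVED 0/9; rung (B)+1 finite T⁴ — NOT infinite volume, NOT mass gap, NOT Clay; HONEST DEPENDENCY: continuum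
YM on T⁴ ⇐ BetaPertH ∧ nine spine estimates (0/9 proved); BetaPertH ⇐ (D1) ∧ (D4) ∧ CAP+tail; G-an2-4 gates asym, D1 and NE2/3/4).  NEW file importing
`B9Thm311SmallFieldCoercivityTowerClosed` and `B9Thm311SmallFieldCoercivityTower`; modifies nothing.  Net new unproved facts: 0.
-/

noncomputable section

open scoped InnerProductSpace ComplexConjugate BigOperators

namespace Literature.MathematicalPhysics.QuantumFieldTheory.Balaban1983to89.B9Thm311LaplaceAkPositiveDiagonal

open B4Sect5Torus (TSite)
open B9SectCLatticeCarrier (Bond)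
open B9Eq319QprimeTorus (fineP)
open B11Eq103H1Complex (SiteL2K BondL2K laplaceALatticeK G1LatticeK laplaceALatticeK_G1LatticeK)
open B9Eq310HessianOperator (adTransportW principalOpK curvOp hessOp hessOp_apply)
open B9Eq310DeltaPrime (plaqHolU)
open B9Eq315QTorus (perCfg cornerSite)
open B9Eq315QTower (towerP UlevOf)
open B9Eq326OperatorTower (laplaceAk)
open B7Prop1Explicit (U1 Wcx boxVec)
open B9Ineq369CurvatureSmall (hpos_of_smallCurvature norm_inner_curvOp_self_le)
open B9Thm311SmallFieldCoercivityTowerClosed (exists_strong_coercive_tower_diagonal_closed)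

variable {d : ℕ} (L : ℕ) [NeZero L] (hL : 1 ≤ L)
  {𝔸 : Type*} [NormedRing 𝔸] [NormedAlgebra ℂ 𝔸] [CompleteSpace 𝔸] [NormOneClass 𝔸] [StarRing 𝔸] [NormedStarGroup 𝔸] [StarModule ℂ 𝔸]
  {W : Type*} [NormedAddCommGroup W] [InnerProductSpace ℂ W] [FiniteDimensional ℂ W] (φ : W ≃ₗ[ℂ] 𝔸)
  {Mφ Mφ' : ℝ} (hMφ : 0 ≤ Mφ) (hMφ' : 0 ≤ Mφ') (hφ : ∀ w, ‖φ w‖ ≤ Mφ * ‖w‖) (hφ' : ∀ X, ‖φ.symm X‖ ≤ Mφ' * ‖X‖)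
  {a : ℝ} (ha : 0 < a) {r : ℝ} (hr0 : 0 ≤ r) (hr1 : r < 1)
  (τ : 𝔸 →ₗ[ℂ] ℂ) {Cτ : ℝ} (hτ : ∀ X, ‖τ X‖ ≤ Cτ * ‖X‖) (hCτ : 0 ≤ Cτ) {ρw : ℝ} (hρw : 0 ≤ ρw)

include hMφ hMφ' hφ hφ' ha hr0 hr1 hτ hCτ hρw

/-- **THE `k`-TH-STEP OPERATOR WITH CURVATURE IS COERCIVE ON THE DIAGONAL, NO OPERATOR LETTER DISPLAYED**: there are `α₀, γ₁ > 0` (closed in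
`(d, a, L, M_φ, M_φ′, r, C_τ, ρ_w)`; `γ₁ = γ(d,a)∕4`) such that for every `n`, `η` (`ηL^{n+1} = 1`), `c₀, c₁` (`c₀(L^{n+1})^d = c₁`, `|η|^d∕c₀ ≤ ρ_w`),
`m`, background `U` of E162's data with `hRS`, `U(b) ∈ U1`, `‖U(b) − 1‖ ≤ αη`, `‖U(∂p) − 1‖ ≤ αη²`, `‖Ū^j(b) − 1‖ ≤ ε_j ≤ αr^j`, and `0 ≤ α ≤ α₀`:
`γ₁‖x‖² ≤ re⟨x, Δ^{(n+1)}_a(U)x⟩` — INTENT-8's `exists_strong_coercive_tower_diagonal_closed` (principal part, `γ′ = γ(d,a)∕2`, the `D`-rows dropped) minus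
the curvature form bound `‖⟨x, Δ′(U)x⟩‖ ≤ 32dC_τM_φ²(|η|^d∕c₀)‖η⁻¹‖²(αη²)‖x‖² ≤ K_c·α‖x‖² ≤ (γ′∕2)‖x‖²` (`B9Ineq369CurvatureSmall.norm_inner_curvOp_self_le`,
`K_c = 32dC_τM_φ²ρ_w`, `α ≤ γ′∕(2(K_c+1))`). [cite: Balaban1985BackgroundPropagators, Thm 3.11 p.416, (3.26) p.395, (3.69) p.404, (3.35) p.396, (3.16) p.393] -/
theorem exists_coercive_laplaceAk_diagonal_closed :
    ∃ α₀ γ₁ : ℝ, 0 < α₀ ∧ 0 < γ₁ ∧ ∀ (n : ℕ) (η : ℝ), η * (L : ℝ) ^ (n + 1) = 1 →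
      ∀ (c₀ c₁ : ℝ) [Fact (0 < c₀)] [Fact (0 < c₁)], c₀ * ((L : ℝ) ^ (n + 1)) ^ d = c₁ → |η| ^ d / c₀ ≤ ρw →
      ∀ (m : Fin d → ℕ) [∀ i, NeZero (m i)] (U : Bond d (towerP L m (n + 1)) → 𝔸ˣ) (αU : ℕ → ℝ) (hα1 : ∀ j, αU j ≤ 1 / 64)
        (hU1 : ∀ (j : ℕ) (x : B7Prop1Explicit.Site d) (κ : Fin d), perCfg (towerP L m (j + 1)) (UlevOf L m (n + 1) U j) x κ ∈ U1 𝔸)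
        (hreg : ∀ (j : ℕ) (y : TSite d (towerP L m j)) (κ : Fin d) (r : Fin d → Fin L),
          ‖((Wcx L (perCfg (towerP L m (j + 1)) (UlevOf L m (n + 1) U j)) (cornerSite L y) κ (boxVec L r) : 𝔸ˣ) : 𝔸) - 1‖ ≤ αU j)
        (εU : ℕ → ℝ), (∀ j, 0 ≤ εU j) → (∀ (j : ℕ) (b : Bond d (towerP L m (j + 1))), ‖(UlevOf L m (n + 1) U j b : 𝔸) - 1‖ ≤ εU j) →
      ∀ {α : ℝ}, 0 ≤ α → α ≤ α₀ →
        (∀ (b : Bond d (towerP L m (n + 1))) (v u : W), ⟪adTransportW φ U b v, u⟫_ℂ = ⟪v, adTransportW φ (fun b => (U b)⁻¹) b u⟫_ℂ) →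
        (∀ b, U b ∈ U1 𝔸) → (∀ b, ‖(U b : 𝔸) - 1‖ ≤ α * η) →
        (∀ p : B9SectCLatticeCarrier.Plaq d (towerP L m (n + 1)), ‖(plaqHolU U p : 𝔸) - 1‖ ≤ α * η ^ 2) →
        (∀ j < n + 1, εU j ≤ α * r ^ j) →
        ∀ x : BondL2K ℂ d (towerP L m (n + 1)) c₀ W,
          γ₁ * ‖x‖ ^ 2 ≤ RCLike.re ⟪x, laplaceAk L m n φ η U hL αU hα1 hU1 hreg τ (c₀ := c₀) (c₁ := c₁) a x⟫_ℂ := by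
  obtain ⟨α₁, γ', hα₁, hγ', H⟩ := exists_strong_coercive_tower_diagonal_closed L hL φ hMφ hMφ' hφ hφ' ha hr0 hr1
  obtain ⟨Kc, hKcdef⟩ : ∃ Kc : ℝ, Kc = 32 * d * Cτ * Mφ ^ 2 * ρw := ⟨_, rfl⟩
  have hKc : 0 ≤ Kc := by rw [hKcdef]; positivity
  refine ⟨min α₁ (γ' / (Kc + 1) / 2), γ' / 2, lt_min hα₁ (by positivity), by positivity, ?_⟩
  intro n η hηL c₀ c₁ _ _ hw hρ m _ U αU hα1 hU1 hreg εU hεU hUε α hα0 hαle hRS hUb hUη hpl hεg x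
  have hc₀ : 0 < c₀ := Fact.out
  have hLr : (0 : ℝ) < (L : ℝ) ^ (n + 1) := pow_pos (by exact_mod_cast Nat.pos_of_ne_zero (NeZero.ne L)) _
  have hηL0 : 0 < η * (L : ℝ) ^ (n + 1) := by rw [hηL]; exact one_pos
  have hη0 : 0 < η := pos_of_mul_pos_left hηL0 hLr.le
  have hγU := H n η hηL c₀ c₁ hw m U αU hα1 hU1 hreg εU hεU hUε hα0 (hαle.trans (min_le_left _ _)) hRS hUb hUη hεg
  -- the principal part: `γ′‖x‖² ≤ re⟨x, Δ_prin x⟩` (drop the `D`-rows)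
  have hprin : γ' * ‖x‖ ^ 2 ≤ RCLike.re ⟪x, laplaceALatticeK ((η : ℂ))⁻¹ (adTransportW φ U) (adTransportW φ fun b => (U b)⁻¹)
      (principalOpK φ η U) (B9Eq326OperatorTower.RofUk L m n φ η U) (B9Eq326OperatorTower.QkW L m n φ U hL αU hα1 hU1 hreg (c₁ := c₁)) a x⟫_ℂ := by
    refine le_trans ?_ (hγU x)
    have h0 : 0 ≤ ‖B9Eq310HessianOperator.covCurlL2K ℂ c₀ ((η : ℂ))⁻¹ (adTransportW φ (fun _ : Bond d (towerP L m (n + 1)) => (1 : 𝔸ˣ))) x‖ ^ 2 +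
        ‖B11Eq103H1Complex.covDivL2K ℂ c₀ ((η : ℂ))⁻¹ (adTransportW φ fun _ : Bond d (towerP L m (n + 1)) => (1 : 𝔸ˣ)⁻¹) x‖ ^ 2 := by positivity
    nlinarith [hγ'.le, sq_nonneg ‖x‖]
  -- the curvature part: `‖⟨x, Δ′(U)x⟩‖ ≤ K_c·α·‖x‖² ≤ (γ′/2)‖x‖²`
  have hUb' : ∀ b : Bond d (towerP L m (n + 1)), ‖(U b : 𝔸)‖ ≤ 1 ∧ ‖(((U b)⁻¹ : 𝔸ˣ) : 𝔸)‖ ≤ 1 := fun b => B7Prop1Explicit.mem_U1.1 (hUb b)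
  have hnη : ‖((η : ℂ))⁻¹‖ ^ 2 * (α * η ^ 2) = α := by
    rw [norm_inv, Complex.norm_real, Real.norm_eq_abs, abs_of_pos hη0]
    field_simp
  have hK := norm_inner_curvOp_self_le φ hτ hCτ hφ η hUb' hpl (by positivity : 0 ≤ α * η ^ 2) x
  rw [hnη] at hK
  have hKα : 32 * d * Cτ * Mφ ^ 2 * (|η| ^ d / c₀) * α ≤ γ' / 2 := by
    have h1 : 32 * d * Cτ * Mφ ^ 2 * (|η| ^ d / c₀) * α ≤ Kc * α := by
      rw [hKcdef]; exact mul_le_mul_of_nonneg_right (mul_le_mul_of_nonneg_left hρ (by positivity)) hα0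
    have hαt : α ≤ γ' / (Kc + 1) / 2 := hαle.trans (min_le_right _ _)
    have h2 : Kc * α ≤ Kc * (γ' / (Kc + 1) / 2) := mul_le_mul_of_nonneg_left hαt hKc
    have h3 : Kc * (γ' / (Kc + 1) / 2) ≤ γ' / 2 := by
      rw [mul_div_assoc', mul_div_assoc', div_div, div_le_div_iff₀ (by positivity) (by norm_num)]
      nlinarith [hγ'.le, hKc]
    linarith
  have hcurv : -(γ' / 2 * ‖x‖ ^ 2) ≤ RCLike.re ⟪x, curvOp φ τ η U x⟫_ℂ := by
    have h := (RCLike.abs_re_le_norm ⟪x, curvOp φ τ η U x⟫_ℂ).trans (hK.trans (mul_le_mul_of_nonneg_right hKα (sq_nonneg _)))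
    rw [abs_le] at h
    exact h.1
  have hsplit : laplaceAk L m n φ η U hL αU hα1 hU1 hreg τ (c₀ := c₀) (c₁ := c₁) a x =
      laplaceALatticeK ((η : ℂ))⁻¹ (adTransportW φ U) (adTransportW φ fun b => (U b)⁻¹) (principalOpK φ η U)
        (B9Eq326OperatorTower.RofUk L m n φ η U) (B9Eq326OperatorTower.QkW L m n φ U hL αU hα1 hU1 hreg (c₁ := c₁)) a x + curvOp φ τ η U x := by
    rw [laplaceAk]
    simp only [laplaceALatticeK, B11Eq103H1Complex.laplaceAK_apply, hessOp_apply]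
    abel
  rw [hsplit, inner_add_right, map_add]
  linarith

/-- **`‖G_k(U)y‖ ≤ γ₁⁻¹‖y‖` ON THE DIAGONAL — [B9] Thm 3.4's `L²` clause for the `k`-th-step Green's function `G(U) = (Δ^{(k)}_a(U))⁻¹`
(`B11Eq103H1Complex.G1LatticeK`, ANY positivity witness) with a LEVEL-FREE constant**: `α₀`, `γ₁` as in `exists_coercive_laplaceAk_diagonal_closed`.
No decay statement. [cite: Balaban1985BackgroundPropagators, Thm 3.4 p.400, Thm 3.11 p.416, (3.86) p.407] -/
theorem exists_norm_G1k_le_diagonal_closed :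
    ∃ α₀ γ₁ : ℝ, 0 < α₀ ∧ 0 < γ₁ ∧ ∀ (n : ℕ) (η : ℝ), η * (L : ℝ) ^ (n + 1) = 1 →
      ∀ (c₀ c₁ : ℝ) [Fact (0 < c₀)] [Fact (0 < c₁)], c₀ * ((L : ℝ) ^ (n + 1)) ^ d = c₁ → |η| ^ d / c₀ ≤ ρw →
      ∀ (m : Fin d → ℕ) [∀ i, NeZero (m i)] (U : Bond d (towerP L m (n + 1)) → 𝔸ˣ) (αU : ℕ → ℝ) (hα1 : ∀ j, αU j ≤ 1 / 64)
        (hU1 : ∀ (j : ℕ) (x : B7Prop1Explicit.Site d) (κ : Fin d), perCfg (towerP L m (j + 1)) (UlevOf L m (n + 1) U j) x κ ∈ U1 𝔸)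
        (hreg : ∀ (j : ℕ) (y : TSite d (towerP L m j)) (κ : Fin d) (r : Fin d → Fin L),
          ‖((Wcx L (perCfg (towerP L m (j + 1)) (UlevOf L m (n + 1) U j)) (cornerSite L y) κ (boxVec L r) : 𝔸ˣ) : 𝔸) - 1‖ ≤ αU j)
        (εU : ℕ → ℝ), (∀ j, 0 ≤ εU j) → (∀ (j : ℕ) (b : Bond d (towerP L m (j + 1))), ‖(UlevOf L m (n + 1) U j b : 𝔸) - 1‖ ≤ εU j) →
      ∀ {α : ℝ}, 0 ≤ α → α ≤ α₀ →
        (∀ (b : Bond d (towerP L m (n + 1))) (v u : W), ⟪adTransportW φ U b v, u⟫_ℂ = ⟪v, adTransportW φ (fun b => (U b)⁻¹) b u⟫_ℂ) →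
        (∀ b, U b ∈ U1 𝔸) → (∀ b, ‖(U b : 𝔸) - 1‖ ≤ α * η) →
        (∀ p : B9SectCLatticeCarrier.Plaq d (towerP L m (n + 1)), ‖(plaqHolU U p : 𝔸) - 1‖ ≤ α * η ^ 2) →
        (∀ j < n + 1, εU j ≤ α * r ^ j) →
        ∀ (hpos : ∀ x : BondL2K ℂ d (towerP L m (n + 1)) c₀ W, x ≠ 0 →
            0 < RCLike.re ⟪x, laplaceAk L m n φ η U hL αU hα1 hU1 hreg τ (c₀ := c₀) (c₁ := c₁) a x⟫_ℂ)
          (y : BondL2K ℂ d (towerP L m (n + 1)) c₀ W), ‖G1LatticeK hpos y‖ ≤ γ₁⁻¹ * ‖y‖ := by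
  obtain ⟨α₀, γ₁, hα₀, hγ₁, H⟩ := exists_coercive_laplaceAk_diagonal_closed L hL φ hMφ hMφ' hφ hφ' ha hr0 hr1 τ hτ hCτ hρw
  refine ⟨α₀, γ₁, hα₀, hγ₁, ?_⟩
  intro n η hηL c₀ c₁ _ _ hw hρ m _ U αU hα1 hU1 hreg εU hεU hUε α hα0 hαle hRS hUb hUη hpl hεg hpos y
  have hcoer := H n η hηL c₀ c₁ hw hρ m U αU hα1 hU1 hreg εU hεU hUε hα0 hαle hRS hUb hUη hpl hεg
  -- `γ₁‖Gy‖² ≤ re⟨Gy, Δ(Gy)⟩ = re⟨Gy, y⟩ ≤ ‖Gy‖‖y‖`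
  have h1 : γ₁ * ‖G1LatticeK hpos y‖ ^ 2 ≤ ‖G1LatticeK hpos y‖ * ‖y‖ := by
    have h := hcoer (G1LatticeK hpos y)
    rw [laplaceAk] at h
    rw [laplaceALatticeK_G1LatticeK] at h
    exact h.trans ((RCLike.re_le_norm _).trans (norm_inner_le_norm _ _))
  by_cases hG : ‖G1LatticeK hpos y‖ = 0
  · rw [hG]; positivity
  · have hGpos : 0 < ‖G1LatticeK hpos y‖ := lt_of_le_of_ne (norm_nonneg _) (Ne.symm hG)
    have h2 : γ₁ * ‖G1LatticeK hpos y‖ ≤ ‖y‖ := by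
      have h3 : (γ₁ * ‖G1LatticeK hpos y‖) * ‖G1LatticeK hpos y‖ ≤ ‖y‖ * ‖G1LatticeK hpos y‖ := by
        calc (γ₁ * ‖G1LatticeK hpos y‖) * ‖G1LatticeK hpos y‖ = γ₁ * ‖G1LatticeK hpos y‖ ^ 2 := by ring
          _ ≤ ‖G1LatticeK hpos y‖ * ‖y‖ := h1
          _ = ‖y‖ * ‖G1LatticeK hpos y‖ := by ring
      exact le_of_mul_le_mul_right h3 hGpos
    calc ‖G1LatticeK hpos y‖ = γ₁⁻¹ * (γ₁ * ‖G1LatticeK hpos y‖) := by field_simp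
      _ ≤ γ₁⁻¹ * ‖y‖ := mul_le_mul_of_nonneg_left h2 (by positivity)

/-- **[B9] THM 3.11 «Δ_a IS POSITIVE DEFINITE» FOR PRINT's `k`-TH-STEP OPERATOR WITH CURVATURE, ON THE DIAGONAL, NO OPERATOR LETTER DISPLAYED**: there is
`α₀ > 0` (closed in `(d, a, L, M_φ, M_φ′, r, C_τ, ρ_w)`) such that for every `n`, `η` (`ηL^{n+1} = 1`), `c₀, c₁` (`c₀(L^{n+1})^d = c₁`, `|η|^d∕c₀ ≤ ρ_w`),
`m`, background `U` of E162's data with `hRS`, `U(b) ∈ U1`, `‖U(b) − 1‖ ≤ αη`, `‖U(∂p) − 1‖ ≤ αη²`, `‖Ū^j(b) − 1‖ ≤ ε_j ≤ αr^j`, and `0 ≤ α ≤ α₀`: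
`0 < re⟨x, Δ^{(n+1)}_a(U)x⟩` for `x ≠ 0` — corollary of `exists_coercive_laplaceAk_diagonal_closed` (same `α₀`).  THE DISPLAYED `hpos` OF
`B9Eq326OperatorTower.G1k ∕ H1k ∕ frakGk` DISCHARGED on the diagonal.
[cite: Balaban1985BackgroundPropagators, Thm 3.11 p.416, (3.26) p.395, (3.69) p.404, (3.35) p.396, (3.16) p.393] -/
theorem exists_laplaceAk_pos_diagonal_closed :
    ∃ α₀ : ℝ, 0 < α₀ ∧ ∀ (n : ℕ) (η : ℝ), η * (L : ℝ) ^ (n + 1) = 1 →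
      ∀ (c₀ c₁ : ℝ) [Fact (0 < c₀)] [Fact (0 < c₁)], c₀ * ((L : ℝ) ^ (n + 1)) ^ d = c₁ → |η| ^ d / c₀ ≤ ρw →
      ∀ (m : Fin d → ℕ) [∀ i, NeZero (m i)] (U : Bond d (towerP L m (n + 1)) → 𝔸ˣ) (αU : ℕ → ℝ) (hα1 : ∀ j, αU j ≤ 1 / 64)
        (hU1 : ∀ (j : ℕ) (x : B7Prop1Explicit.Site d) (κ : Fin d), perCfg (towerP L m (j + 1)) (UlevOf L m (n + 1) U j) x κ ∈ U1 𝔸)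
        (hreg : ∀ (j : ℕ) (y : TSite d (towerP L m j)) (κ : Fin d) (r : Fin d → Fin L),
          ‖((Wcx L (perCfg (towerP L m (j + 1)) (UlevOf L m (n + 1) U j)) (cornerSite L y) κ (boxVec L r) : 𝔸ˣ) : 𝔸) - 1‖ ≤ αU j)
        (εU : ℕ → ℝ), (∀ j, 0 ≤ εU j) → (∀ (j : ℕ) (b : Bond d (towerP L m (j + 1))), ‖(UlevOf L m (n + 1) U j b : 𝔸) - 1‖ ≤ εU j) →
      ∀ {α : ℝ}, 0 ≤ α → α ≤ α₀ →
        (∀ (b : Bond d (towerP L m (n + 1))) (v u : W), ⟪adTransportW φ U b v, u⟫_ℂ = ⟪v, adTransportW φ (fun b => (U b)⁻¹) b u⟫_ℂ) →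
        (∀ b, U b ∈ U1 𝔸) → (∀ b, ‖(U b : 𝔸) - 1‖ ≤ α * η) →
        (∀ p : B9SectCLatticeCarrier.Plaq d (towerP L m (n + 1)), ‖(plaqHolU U p : 𝔸) - 1‖ ≤ α * η ^ 2) →
        (∀ j < n + 1, εU j ≤ α * r ^ j) →
        ∀ x : BondL2K ℂ d (towerP L m (n + 1)) c₀ W, x ≠ 0 →
          0 < RCLike.re ⟪x, laplaceAk L m n φ η U hL αU hα1 hU1 hreg τ (c₀ := c₀) (c₁ := c₁) a x⟫_ℂ := by
  obtain ⟨α₀, γ₁, hα₀, hγ₁, H⟩ := exists_coercive_laplaceAk_diagonal_closed L hL φ hMφ hMφ' hφ hφ' ha hr0 hr1 τ hτ hCτ hρw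
  refine ⟨α₀, hα₀, ?_⟩
  intro n η hηL c₀ c₁ _ _ hw hρ m _ U αU hα1 hU1 hreg εU hεU hUε α hα0 hαle hRS hUb hUη hpl hεg x hx
  have h := H n η hηL c₀ c₁ hw hρ m U αU hα1 hU1 hreg εU hεU hUε hα0 hαle hRS hUb hUη hpl hεg x
  have hx2 : 0 < ‖x‖ ^ 2 := by positivity
  nlinarith

end Literature.MathematicalPhysics.QuantumFieldTheory.Balaban1983to89.B9Thm311LaplaceAkPositiveDiagonal

end
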